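import Summits.BirchSwinnertonDyer.BirchSwinnertonDyer.Theorems.RamifiedHeegnerPairLeafUpperMembersOfSigma
import Summits.BirchSwinnertonDyer.BirchSwinnertonDyer.Theorems.RamifiedHeegnerPairGss2LowerAtThreeRankOneKolyvaginRoadOfRefinedKolyvagin
import HarnessLib

/-!
# Route `RamifiedHeegnerPair` (rev 7) — the W-ALL leaf Gss2 at `3` from PRINT ∧ Kolyvagin's structure theorem ∧ the REFINED
# KOLYVAGIN CONJECTURE at an additive `3` in BOTH directions on the leaf's Heegner data ∧ L₀ ∧ [L₁ on the non-tower rows]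
# (joint capstone of the two leads' lines: rhp-p2 g3's Σ★ for U₁/U₀, rhp-p1 g3's T1⁻ road for L₁)

HONEST FRAMING. Theorems only; helper file (`--supports stmt-BirchSwinnertonDyer-26021 --as helper`); nothing is booked, no item is
closed, BSD is not proved for any curve; CONDITIONAL on every displayed input (audit `proof.conditional`). Lead prover bsd-line-rhp-p1
g3 with rhp-p2 g3's capstone p613148, 2026-08-28.

WHAT. rhp-p2 g3's `wAllExclAddGssAtThree_of_lowerMembers_of_sigmaStar` (p613148) discharges BOTH upper binders of the route's
`closes (hP hL1 hU1 hL0 hU0)` from print + ONE orientation-free research statement Σ★ (the Σ-form global 3-DIVISIBILITY of derived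
Heegner points beyond the Tamagawa–Manin budget on the leaf's Heegner data = Jetchev 2008 Conj. 1.3 / `AdditiveThree.RKC3Divisibility`
direction, read at the additive `3`), leaving the two LOWER members `hL1 : Gss2LowerAtThreeRankOne` (26021) and
`hL0 : Gss2LowerAtThreeRankZero` (26023). This file plugs in rhp-p1 g3's road for `hL1` (p612743
`gss2LowerAtThreeRankOne_of_structure_of_rkc3Indivisibility_of_nonTower`): on the 3-adic-tower rows L₁ is print ∧ Kolyvagin's structure
theorem at `3` in its lower one-class form (`AdditiveThree.OneClassLowerBoundShape`) ∧ the INDIVISIBILITY half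
`AdditiveThree.RKC3Indivisibility` (T1⁻: some Kolyvagin class NOT `3^{t+1}`-divisible, `t = ord₃∏c(E)` — W. Zhang 2014 / BCGS direction).

* `wAllExclAddGssAtThree_of_sigmaStar_of_rkc3Indivisibility_of_structure_of_lowerRankZero_of_nonTower` — the leaf
  `Summit.BirchSwinnertonDyer.WAllExclAddGssAtThree` ⟸ PRINT (the union of the two leads' named-fact binders: Gross–Zagier I.(6.3)/(7.3),
  Kolyvagin, GZK, modularity ×3, Matar–Nekovář Thm. 0.7, Friedberg–Hoffstein ×2, Bump–Friedberg–Hoffstein, Kato 14.5(3)+14.16(2)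
  Tamagawa-exact, Mazur / Abbes–Ullmo / Česnavičius Manin facts) ∧ Σ★ ∧ `OneClassLowerBoundShape` ∧ `RKC3Indivisibility` ∧ L₀ ∧
  [L₁ on the Gss2 rank-one rows WITHOUT 3-adic tower surjectivity].

PLANNER'S READING (both leads agree): for RHP as re-keyed, the Heegner–Kolyvagin side of BSD₃ on the Gss2 leaf is, beyond print, the
refined Kolyvagin conjecture at the additive `3` in its two directions (Σ★ ⊇ T1⁺-shape for the UPPER members; T1⁻ + the structure
theorem for the rank-one LOWER member on the tower rows) — `AdditiveThree.RefinedKolyvaginAdditiveThree`-type content, typed by cell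
b2b/o5o6, per-pair certifiable/falsifiable (Jetchev–Lauter–Stein 2009) — PLUS L₀ (Kato IMC ⊇ at an additive `3`, rank 0: Fouquet–Wan
locus PRE, open off it) and the non-tower rank-one rows of L₁. The 3-RAMIFIED Heegner field of the thesis is used by none of the four
member lines. CONDITIONAL; every ∀-statement stays OPEN.

References: [cite: Jetchev2008, Conj. 1.3 (p. 812), Thm. 1.4] [cite: WZhang2014, Thm. 1.1, §3.8, Thm. 10.2, Remark 18]
[cite: McCallumLMS1991, Thm. 5.4 (p. 288), Thm. 5.8 (p. 290)] [cite: MatarNekovar2019, Thm. 0.7 (p. 456)] [cite: Kato2004Asterisque,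
Thm. 14.5 (3) (p. 236), Prop. 14.16 (2) (p. 244)] [cite: GrossZagier1986, Thm. I.(6.3) and (7.3)] [cite: JetchevLauterStein2009,
Prop. 4.1–4.2] [cite: Miller2011LMS, §1 and Def. 1.1].
-/

-- D-0017: single-problem summit, so `Summit.BirchSwinnertonDyer.BirchSwinnertonDyer.…` repeats a namespace BY DESIGN.
set_option linter.dupNamespace false
set_option autoImplicit false

noncomputable section

open scoped Classical NumberField

open WeierstrassCurve Literature Literature.NumberTheory.EllipticCurves
  Literature.NumberTheory.EllipticCurves.ModularForms
  Literature.NumberTheory.EllipticCurves.Rank1Residual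
  Literature.NumberTheory.EllipticCurves.Rank1Residual.Typed
  Summit.BirchSwinnertonDyer.Rank1Residual Summit.BirchSwinnertonDyer.Rank1Residual.Additive
  Summit.BirchSwinnertonDyer.Rank1Residual.X11b Summit.BirchSwinnertonDyer.Rank1Residual.X11b.Three
  Summit.BirchSwinnertonDyer.BirchSwinnertonDyer.Theses.RamifiedHeegnerPair
  Summit.BirchSwinnertonDyer.BirchSwinnertonDyer.Theorems

namespace Summit.BirchSwinnertonDyer.BirchSwinnertonDyer.Theorems.RamifiedPairLowerBound

/-- **The W-ALL leaf Gss2 at `3` ⟸ PRINT ∧ Σ★ ∧ Kolyvagin's structure theorem (lower one-class form) ∧ `RKC3Indivisibility` ∧ L₀ ∧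
[L₁ on the non-tower rank-one rows].** Composition of rhp-p2 g3's capstone `wAllExclAddGssAtThree_of_lowerMembers_of_sigmaStar`
(p613148: PUB★ → Σ★ → L₁ → L₀ → leaf, through the route's `closes`) with rhp-p1 g3's
`gss2LowerAtThreeRankOne_of_structure_of_rkc3Indivisibility_of_nonTower` (p612743) for L₁. `hpubU` = rhp-p2's ten print facts; the
separate binders `hKatoT hFH hMz hAU hC2` are the L₁ road's additional print inputs (Kato 14.5(3)+14.16(2) Tamagawa-exact for the rank-0
twist; Friedberg–Hoffstein split field; Manin constant of the optimal curve on an `Iₙ*` class); `hStar` = Σ★ verbatim; `hSL`, `hT1` the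
b2b/o5o6 typed structure shape and T1⁻; `hL0` = item 26023; `hNT` = L₁ on the rows without `ρ_{E,3^n}` onto for all `n`.
CONDITIONAL (conditional-result); credits nothing; BSD is not proved. [cite: Jetchev2008, Conj. 1.3 (p. 812)] [cite: WZhang2014, Thm. 1.1
and Remark 18] [cite: McCallumLMS1991, Thm. 5.4 (p. 288)] [cite: MatarNekovar2019, Thm. 0.7 (p. 456)] [cite: Kato2004Asterisque, Thm. 14.5 (3)
(p. 236)] [cite: Miller2011LMS, §1 and Def. 1.1] -/
theorem wAllExclAddGssAtThree_of_sigmaStar_of_rkc3Indivisibility_of_structure_of_lowerRankZero_of_nonTower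
    (hpubU : (∀ (N : ℕ) [NeZero N] (W : WeierstrassCurve ℚ) (K : Type) [Field K] [NumberField K], gross_zagier N W K) ∧
      (∀ (N : ℕ) [NeZero N] (W : WeierstrassCurve ℚ) (K : Type) [Field K] [NumberField K], kolyvagin N W K) ∧
      rank_eq_analyticRank_of_analyticRank_le_one ∧ WeierstrassCurve.hasEntireLFunction_rat ∧ GrossZagier1986_thm_I_7_3 ∧
      MatarNekovar2019.thm07_padicValNat_card_sha_primary_add_le_of_globalDivisibility_of_irreducible ∧ exists_isNewformOf ∧
      friedbergHoffstein_exists_heegnerField_splitDivisors_twist_ne_zero ∧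
      bumpFriedbergHoffstein_exists_heegnerField_split_twist_simpleZero ∧ nonempty_modularParametrizationData)
    (hKatoT : Kato2004.rankZero_padicValNat_sha_add_padicValNat_tamagawa_le_of_additive_potGood_of_imageContainsSL2)
    (hFH : friedbergHoffstein_exists_heegnerField_split_twist_ne_zero)
    (hMz : mazur_not_dvd_maninConstant_of_odd)
    (hAU : abbesUllmo_not_dvd_maninConstant_of_not_dvd_level)
    (hC2 : cesnavicius_not_two_dvd_maninConstant_of_two_dvd_level)
    (hStar : ∀ (W : WeierstrassCurve ℚ) [W.IsElliptic] [W.IsGloballyMinimal] (N : ℕ) [NeZero N]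
      (K : Type) [Field K] [NumberField K] (Dt : ModularParametrizationData W N)
      (H : HeegnerDatum N (NumberField.discr K)) (ι : K →+* ℂ) (P : (W.baseChange K).toAffine.Point),
      ¬ W.HasCM → Addv W 3 → SubGss W 3 → W.conductorNorm ℤ = N → IsImaginaryQuadratic K →
      SatisfiesHeegnerHypothesis N K →
      (WeierstrassCurve.Affine.Point.map ι.toRatAlgHom) P = heegnerPointComplex Dt H → ¬ IsOfFinAddOrder P →
      Odd (NumberField.discr K) →
      ∀ (s' : ℕ), s' ≤ padicValNat 3 W.tamagawaProduct + padicValNat 3 Dt.c.natAbs →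
      ∀ (n : ℕ) (d : KolyvaginHeegnerData Dt H.β ι n), Squarefree n →
      (∀ ℓ ∈ n.primeFactors, Zhang2014.IsKolyvaginPrime N W K 3 ℓ ∧ s' ≤ Zhang2014.kolyvaginIndex W 3 ℓ) → Koly.PDiv d 3 s')
    (hSL : AdditiveThree.OneClassLowerBoundShape) (hT1 : AdditiveThree.RKC3Indivisibility)
    (hL0 : Gss2LowerAtThreeRankZero)
    (hNT : ∀ (W : WeierstrassCurve ℚ) [W.IsElliptic] [W.IsGloballyMinimal],
      ¬ W.HasCM → Addv W 3 → SubGss W 3 → W.analyticRank = 1 →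
      ¬ (∀ n : ℕ, W.HasSurjectiveModNGaloisRep (3 ^ n : ℕ)) → MissingLowerBoundAt W 3) :
    Summit.BirchSwinnertonDyer.WAllExclAddGssAtThree := by
  have hGZ := hpubU.1
  have hKo := hpubU.2.1
  have hGZK := hpubU.2.2.1
  have hmod := hpubU.2.2.2.1
  have hnf := hpubU.2.2.2.2.2.2.1
  exact RamifiedPairUpperBound.wAllExclAddGssAtThree_of_lowerMembers_of_sigmaStar hpubU hStar
    (gss2LowerAtThreeRankOne_of_structure_of_rkc3Indivisibility_of_nonTower hGZ hKo hKatoT hGZK hmod hnf hFH hMz hAU hC2 hSL hT1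
      hNT)
    hL0

end Summit.BirchSwinnertonDyer.BirchSwinnertonDyer.Theorems.RamifiedPairLowerBound

end
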